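import Literature.Probability.Percolation.StaircaseSchedule
import HarnessLib

/-!
# The level table of the staircase corridors

Topic: Probability / Percolation; family `crit-perc`. A brick of the GENERIC landing layer of
Nolin's arm-separation theorem (Nolin 2008, Thm. 11, §4.4 [arXiv 0711.4948: Thm. 10, p. 12,
Fig. 6: "RSW in corridors"]), towards
`Literature.Probability.Percolation.Nolin2008_prop17_quasiMult` (`FiveArmExponentFacts.lean`).

From the schedule of `StaircaseSchedule.lean` (two right sweeps, then two left sweeps, one mover
per level) this file assembles the LEVEL TABLE `Staircase.table C δ T p t : Fin k → ℤ`,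
`t = 0, …, 4k`: the lateral positions of the `k` corridors on the ring of level `t`. It starts
at the keys `p` (`table_zero`), keeps the invariant `Inv C δ` (sorted, `δ`-separated, within a
turn) at every level (`inv_table`), changes at most ONE position per level, which moves within
its gap — to the right by at most its right bound minus `δ` in the first `2k` levels
(`table_succ_right`), to the left down to its left bound plus `δ` in the last `2k`
(`table_succ_left`) — and ends at the targets `T` (`table_final`).

## Main definitions

* `Staircase.lb C p j` — the left bound (previous position, or the last one a turn back);
* `Staircase.tableR`, `Staircase.table`.

## Main results

* `Staircase.table_zero`, `Staircase.inv_table`, `Staircase.table_succ_right`,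
  `Staircase.table_succ_left`, `Staircase.table_final`.

## References

* P. Nolin, *Near-critical percolation in two dimensions*, Electron. J. Probab. 13 (2008), §4.4
  (arXiv 0711.4948: proof of Thm. 10, p. 12, Fig. 6). [Nolin2008]
* H. Kesten, *Scaling relations for 2D-percolation*, Comm. Math. Phys. 109 (1987), Lemma 4.
  [Kesten1987]
-/

namespace Literature.Probability.Percolation

namespace Staircase

variable {k : ℕ} (C δ : ℤ) (T : Fin k → ℤ)

/-- The left bound of the index `j`: the previous position, or the last one a full turn back. [folklore] -/
def lb (p : Fin k → ℤ) (j : Fin k) : ℤ :=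
  if h : 1 ≤ j.val then p ⟨j.val - 1, by omega⟩ else p ⟨k - 1, by have := j.isLt; omega⟩ - C

/-- The first `2k + 1` levels: the two right sweeps, move by move. [folklore] -/
def tableR (p : Fin k → ℤ) (t : ℕ) : Fin k → ℤ :=
  if t ≤ k then procR C δ T p t else procR C δ T (sweepR C δ T p) (t - k)

/-- **The level table**: two right sweeps (levels `0 … 2k`), then two left sweeps by reflection
(levels `2k … 4k`). [cite: Nolin2008, §4.4 (arXiv 0711.4948: proof of Thm. 10, p. 12, Fig. 6)] -/
def table (p : Fin k → ℤ) (t : ℕ) : Fin k → ℤ :=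
  if t ≤ 2 * k then tableR C δ T p t
  else refl (tableR C δ (refl T) (refl (tableR C δ T p (2 * k))) (t - 2 * k))

variable {C δ T} {p : Fin k → ℤ}

/-! ### The right phase -/

/-- Level `0` is the row of keys. [folklore] -/
theorem table_zero : table C δ T p 0 = p := by
  simp [table, tableR, procR]

/-- `tableR` at `2k` is the double right sweep. [folklore] -/
theorem tableR_two_mul : tableR C δ T p (2 * k) = sweepR C δ T (sweepR C δ T p) := by
  unfold tableR
  by_cases hk : k = 0
  · subst hk; simp [sweepR, procR]
  · rw [if_neg (by omega), show 2 * k - k = k by omega]; rfl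

/-- The invariant along the right phase. [folklore] -/
theorem inv_tableR (hI : Inv C δ p) (t : ℕ) : Inv C δ (tableR C δ T p t) := by
  unfold tableR
  split_ifs
  · exact inv_procR hI t
  · exact inv_procR (inv_procR hI k) _

/-- **One level of the right phase**: from the level `t < 2k` to `t + 1` only the mover
`m = k - 1 - (t mod k)` may change, advancing by at most its right bound minus `δ`. [folklore] -/
theorem tableR_succ (hI : Inv C δ p) {t : ℕ} (ht : t < 2 * k) :
    ∃ m : Fin k, (∀ j, j ≠ m → tableR C δ T p (t + 1) j = tableR C δ T p t j) ∧
      tableR C δ T p t m ≤ tableR C δ T p (t + 1) m ∧ tableR C δ T p (t + 1) m ≤ rb C (tableR C δ T p t) m - δ := by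
  have hk : 0 < k := by omega
  -- the row before the move and the generic step
  have key : ∀ (q : Fin k → ℤ), Inv C δ q → ∀ n, n < k →
      ∃ m : Fin k, (∀ j, j ≠ m → procR C δ T q (n + 1) j = procR C δ T q n j) ∧
        procR C δ T q n m ≤ procR C δ T q (n + 1) m ∧ procR C δ T q (n + 1) m ≤ rb C (procR C δ T q n) m - δ := by
    intro q hq n hn
    refine ⟨⟨k - 1 - n, by omega⟩, fun j hj => ?_, ?_, ?_⟩
    · rw [procR_succ, dif_pos hn, stepR_apply_ne hj]
    · rw [procR_succ, dif_pos hn]; exact le_stepR (inv_procR hq n) _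
    · rw [procR_succ, dif_pos hn]; exact stepR_le_rb (inv_procR hq n)
  by_cases h1 : t < k
  · obtain ⟨m, hm⟩ := key p hI t h1
    refine ⟨m, ?_⟩
    simp only [tableR, if_pos (show t + 1 ≤ k by omega), if_pos (show t ≤ k by omega)]
    exact hm
  · obtain ⟨m, hm⟩ := key (sweepR C δ T p) (inv_procR hI k) (t - k) (by omega)
    refine ⟨m, ?_⟩
    have e1 : tableR C δ T p (t + 1) = procR C δ T (sweepR C δ T p) (t - k + 1) := by
      unfold tableR; rw [if_neg (by omega), show t + 1 - k = t - k + 1 by omega]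
    have e0 : tableR C δ T p t = procR C δ T (sweepR C δ T p) (t - k) := by
      unfold tableR
      by_cases h2 : t = k
      · subst h2; rw [if_pos le_rfl, Nat.sub_self]; rfl
      · rw [if_neg (by omega)]
    rw [e1, e0]
    exact hm

/-! ### The whole table -/

/-- **The invariant at every level.** [folklore] -/
theorem inv_table (hI : Inv C δ p) (t : ℕ) : Inv C δ (table C δ T p t) := by
  unfold table
  split_ifs
  · exact inv_tableR hI t
  · exact inv_refl (inv_tableR (inv_refl (inv_tableR hI _)) _)

/-- **One level of the right phase of the table** (`t < 2k`). [folklore] -/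
theorem table_succ_right (hI : Inv C δ p) {t : ℕ} (ht : t < 2 * k) :
    ∃ m : Fin k, (∀ j, j ≠ m → table C δ T p (t + 1) j = table C δ T p t j) ∧
      table C δ T p t m ≤ table C δ T p (t + 1) m ∧ table C δ T p (t + 1) m ≤ rb C (table C δ T p t) m - δ := by
  simp only [table, if_pos (show t + 1 ≤ 2 * k by omega), if_pos (show t ≤ 2 * k by omega)]
  exact tableR_succ hI ht

/-- The right bound of the reflected row is the reflected left bound. [folklore] -/
theorem rb_refl (q : Fin k → ℤ) (m : Fin k) : rb C (refl q) (Fin.rev m) = -lb C q m := by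
  have hv : (Fin.rev m).val = k - (m.val + 1) := Fin.val_rev m
  unfold rb lb refl
  by_cases h : 1 ≤ m.val
  · rw [dif_pos (show (Fin.rev m).val + 1 < k by omega), dif_pos h]
    have e : Fin.rev (⟨(Fin.rev m).val + 1, by omega⟩ : Fin k) = ⟨m.val - 1, by omega⟩ :=
      Fin.ext (by rw [Fin.val_rev]; show k - ((Fin.rev m).val + 1 + 1) = m.val - 1; omega)
    rw [e]
  · rw [dif_neg (show ¬ ((Fin.rev m).val + 1 < k) by omega), dif_neg h]
    have e : Fin.rev (⟨0, lt_of_le_of_lt (Nat.zero_le _) (Fin.rev m).isLt⟩ : Fin k) = ⟨k - 1, by have := m.isLt; omega⟩ :=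
      Fin.ext (by rw [Fin.val_rev])
    rw [e]
    ring

/-- `tableR` at `0` is the given row. [folklore] -/
theorem tableR_zero {T' : Fin k → ℤ} (q : Fin k → ℤ) : tableR C δ T' q 0 = q := by
  unfold tableR; rw [if_pos (Nat.zero_le _)]; rfl

/-- The levels `2k + u` through the reflection. [folklore] -/
theorem table_two_mul_add (u : ℕ) :
    table C δ T p (2 * k + u) = refl (tableR C δ (refl T) (refl (tableR C δ T p (2 * k))) u) := by
  unfold table
  by_cases hu : u = 0
  · subst hu
    rw [if_pos (by omega), Nat.add_zero, tableR_zero, refl_refl]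
  · rw [if_neg (by omega), Nat.add_sub_cancel_left]

/-- **One level of the left phase of the table** (`2k ≤ t < 4k`): only the mover may change,
retreating by at most its left bound plus `δ`. [folklore] -/
theorem table_succ_left (hI : Inv C δ p) {t : ℕ} (ht1 : 2 * k ≤ t) (ht2 : t < 4 * k) :
    ∃ m : Fin k, (∀ j, j ≠ m → table C δ T p (t + 1) j = table C δ T p t j) ∧
      table C δ T p (t + 1) m ≤ table C δ T p t m ∧ lb C (table C δ T p t) m + δ ≤ table C δ T p (t + 1) m := by
  set q₂ := tableR C δ T p (2 * k) with hq₂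
  have hIq : Inv C δ (refl q₂) := inv_refl (inv_tableR hI _)
  obtain ⟨m', hfix, hlo, hhi⟩ := tableR_succ (T := refl T) hIq (t := t - 2 * k) (by omega)
  -- the two levels through the reflection
  have e1 : table C δ T p (t + 1) = refl (tableR C δ (refl T) (refl q₂) (t - 2 * k + 1)) := by
    rw [show t + 1 = 2 * k + (t - 2 * k + 1) by omega]; exact table_two_mul_add _
  have e0 : table C δ T p t = refl (tableR C δ (refl T) (refl q₂) (t - 2 * k)) := by
    rw [show t = 2 * k + (t - 2 * k) by omega]
    rw [table_two_mul_add]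
    rw [show 2 * k + (t - 2 * k) - 2 * k = t - 2 * k by omega]
  refine ⟨Fin.rev m', fun j hj => ?_, ?_, ?_⟩
  · rw [e1, e0]
    simp only [refl]
    rw [hfix (Fin.rev j) (fun h => hj (by rw [← Fin.rev_rev j, h]))]
  · rw [e1, e0]; simp only [refl, Fin.rev_rev]; linarith
  · rw [e1, e0]
    have hb := rb_refl (C := C) (refl (tableR C δ (refl T) (refl q₂) (t - 2 * k))) (Fin.rev m')
    rw [refl_refl, Fin.rev_rev] at hb
    simp only [refl, Fin.rev_rev]
    rw [hb] at hhi
    linarith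

/-- **The table ends at the targets** (`T` with the invariant, `kδ ≤ C`, the last target less
than two turns ahead of the first key and the first target less than two turns behind the last
key: `T_{k-1} ≤ p₀ + 2C - (k+1)δ`, `p_{k-1} - 2C + (k+1)δ ≤ T₀`). [cite: Nolin2008, §4.4 (arXiv 0711.4948: proof of Thm. 10, p. 12, Fig. 6)] -/
theorem table_final (hI : Inv C δ p) (hT : Inv C δ T) (hkδ : (k : ℤ) * δ ≤ C) (hk : 0 < k)
    (hTk : T ⟨k - 1, by omega⟩ ≤ p ⟨0, hk⟩ + 2 * C - ((k : ℤ) + 1) * δ)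
    (hT0 : p ⟨k - 1, by omega⟩ - 2 * C + ((k : ℤ) + 1) * δ ≤ T ⟨0, hk⟩) :
    table C δ T p (4 * k) = T := by
  set q₂ := tableR C δ T p (2 * k) with hq₂
  have hq₂' : q₂ = sweepR C δ T (sweepR C δ T p) := tableR_two_mul
  have hIq₂ : Inv C δ q₂ := inv_tableR hI _
  -- after the right phase: right-movers at their targets, the others unchanged
  have hR : ∀ j, p j ≤ T j → q₂ j = T j := fun j hj => by rw [hq₂']; exact sweepR_sweepR_eq_target hI hT hkδ hk hTk j hj
  have hF : ∀ j, T j ≤ p j → q₂ j = p j := fun j hj => by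
    rw [hq₂']
    have h1 : sweepR C δ T p j = p j := procR_apply_of_target_le hI j hj k
    rw [show sweepR C δ T (sweepR C δ T p) j = sweepR C δ T p j from
      procR_apply_of_target_le (inv_procR hI k) j (by have := hj; rwa [← h1] at this) k, h1]
  have hle : ∀ j, T j ≤ q₂ j ∨ q₂ j = T j := fun j => by
    rcases le_total (p j) (T j) with h | h
    · exact Or.inr (hR j h)
    · exact Or.inl (by rw [hF j h]; exact h)
  -- the left phase
  have e : table C δ T p (4 * k) = sweepL C δ T (sweepL C δ T q₂) := by
    unfold table
    rw [if_neg (by omega), show 4 * k - 2 * k = 2 * k by omega, tableR_two_mul]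
    unfold sweepL
    rw [refl_refl]
  rw [e]
  have hT0' : q₂ ⟨k - 1, by omega⟩ - 2 * C + ((k : ℤ) + 1) * δ ≤ T ⟨0, hk⟩ := by
    rcases le_total (p ⟨k - 1, by omega⟩) (T ⟨k - 1, by omega⟩) with h | h
    · rw [hR _ h]
      have hw := hT.2 ⟨k - 1, by omega⟩ ⟨0, hk⟩ (show k - 1 + 1 = k by omega) rfl
      nlinarith
    · rw [hF _ h]; exact hT0
  funext j
  rcases hle j with h | h
  · exact sweepL_sweepL_eq_target hIq₂ hT hkδ hk hT0' j h
  · -- already at the target: never moves in the left phase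
    have h' : T j ≤ q₂ j := h.ge
    exact sweepL_sweepL_eq_target hIq₂ hT hkδ hk hT0' j h'

end Staircase

end Literature.Probability.Percolation
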